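import Summits.SmoothPoincare4.SmoothPoincare4.Theorems.ConvexBisectionAcyclicBisectionExistsDualHandleModelInj
import Summits.SmoothPoincare4.SmoothPoincare4.Theorems.ConvexBisectionAcyclicBisectionExistsDualHandleModelRegionDefs
import HarnessLib

/-!
# Dual handles, XI: the image of the model dual handle map is `Dome ∪ N`
(brick (F-image) of the sub-goal T3b "the complement of the prefix sub-handlebody is the other
piece with the DUAL suffix handles" of stub `stub_steinRealisation` (NF6), line
`modp-braid-orbits` r11, crux `ConvexBisection.AcyclicBisectionExists`,
item stmt-SmoothPoincare4-10508; wave 3, lead c5, worker Z2)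

Sequel of `…DualHandleModelInj.lean` and `…DualHandleModelRegionDefs.lean`.  The model map
`𝓕 = modelF a κ δ` keeps the torus directions `(ẑ_μ, ẑ_λ)` and acts on the squared part-norms by
`Λ (s, u) = (P, Q) = (u·𝓅(s), s·q̃(s,u))`, `s = ‖z_λ‖² ∈ [0, 1)`, `u = ‖z_μ‖²/(1 - s) ∈ [0, 1]`.
Here we compute the image of `Λ` on `[0,1) × [0,1]` (V5 report §3.1 (F-image), §3.2):

* `mem_image_modelF_iff` — `x ∈ 𝓕 (D⁴ ∖ S)` iff `(‖x_λ‖², ‖x_μ‖²) = Λ (s, u)` for some admissible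
  `(s, u)` (`exists_preimage_of_param`: the preimage is rebuilt from the parts of `x`);
* `region_of_param` — `Λ([0,1) × [0,1]) ⊆ Dome ∪ N` read in the quarter plane: the swap slab
  `s ≤ 1/2` gives `Q = δ s ≤ δ/2`, `P ≤ 𝓅(Q/δ)`; the top zone `s > 1/2` gives `P = κ² s u < κ²`,
  `Q = qHat P s ∈ [𝒸(P) ∨ δ/2, 1 + g(δ(1 - P/κ²)) - P)` (`qHat_lt_qHat`, `qHat_lt_top`);
* `exists_param_top` — conversely every `(P, Q)` with `0 ≤ P < κ²`,
  `max (δ/2) 𝒸(P) ≤ Q < 1 + g(δ(1 - P/κ²)) - P` is `Λ (s, P/(κ² s))` for some `s ∈ [1/2 ∨ P/κ², 1)`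
  (intermediate value theorem for the continuous increasing `qHat P`), and the slab part of `N`
  is `Λ (Q/δ, P/𝓅(Q/δ))` (`param_of_region`);
* **`image_modelF_eq`: `modelF a κ δ '' {‖z‖ ≤ 1, ‖z_λ‖² < 1} = dualDome a κ δ ∪ cocoreNbhd κ δ`**
  (registered as `helper_image_modelF`), and `dualVec_mem_dualDome` (`Π(T) ⊆ Dome`).

Constants: `0 < a`, `0 < κ ≤ 1/2`, `0 < δ ≤ 1/2` (as in `injOn_modelF`).  Everything here is
proved; no named facts.

## References
* J. Milnor, *Lectures on the h-cobordism theorem* (1965), §3 (dual handles). [MilnorHCobordism1965]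
* A. A. Kosinski, *Differential Manifolds* (1993), VI §6. [Kosinski1993]
-/

noncomputable section

-- the prescribed namespace `Summit.<P>.<Sub>.…` duplicates `SmoothPoincare4` (P = Sub)
set_option linter.dupNamespace false

open scoped Manifold ContDiff Topology

namespace Summit.SmoothPoincare4.SmoothPoincare4.Theorems.AcyclicBisectionExists.ModpBraidOrbits

open Set Function Metric
open Literature.Topology.FourManifolds Literature.Topology.FourManifolds.HandleAttachingMap

/-! ### §1 The image is read on the squared part-norms -/

section Param

/-- **The preimage rebuilt from the parts**: if `(‖x_λ‖², ‖x_μ‖²) = (u·𝓅(s), s·q̃(s,u))` with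
`0 ≤ s < 1`, `0 ≤ u ≤ 1`, then `z = (x_μ/√q̃, x_λ/√(𝓅/(1-s)))` has `‖z_λ‖² = s`,
`‖z_μ‖² = u(1 - s)` and `𝓕 z = x`. [cite: MilnorHCobordism1965, §3] -/
theorem exists_preimage_of_param {a κ δ : ℝ} (ha : 0 < a) (hκ : 0 < κ) (hκ2 : κ ≤ 1 / 2) (hδ : 0 < δ)
    (hδ2 : δ ≤ 1 / 2) {x : EuclideanSpace ℝ (Fin 4)} {s u : ℝ} (hs0 : 0 ≤ s) (hs1 : s < 1)
    (hu0 : 0 ≤ u) (hu1 : u ≤ 1) (hP : ‖lamPart x‖ ^ 2 = u * pFun κ s)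
    (hQ : ‖muPart x‖ ^ 2 = s * qTilde a κ δ s u) :
    ∃ z : EuclideanSpace ℝ (Fin 4), sOf z = s ∧ ‖muPart z‖ ^ 2 = u * (1 - s) ∧ modelF a κ δ z = x := by
  have hq : 0 < qTilde a κ δ s u := qTilde_pos ha hκ hκ2 hδ hδ2 hs0 hs1 hu0 hu1
  have hp : 0 < pFun κ s / (1 - s) := div_pos (pFun_pos hκ hs0) (by linarith)
  set A := Real.sqrt (qTilde a κ δ s u) with hA
  set B := Real.sqrt (pFun κ s / (1 - s)) with hB
  have hA0 : 0 < A := Real.sqrt_pos.2 hq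
  have hB0 : 0 < B := Real.sqrt_pos.2 hp
  have hA2 : A ^ 2 = qTilde a κ δ s u := Real.sq_sqrt hq.le
  have hB2 : B ^ 2 = pFun κ s / (1 - s) := Real.sq_sqrt hp.le
  set z : EuclideanSpace ℝ (Fin 4) := lamEmbed (A⁻¹ • muPart x) + muEmbed (B⁻¹ • lamPart x) with hz
  have hzl : lamPart z = A⁻¹ • muPart x := by
    rw [hz, lamPart_add, lamPart_lamEmbed, lamPart_muEmbed, add_zero]
  have hzm : muPart z = B⁻¹ • lamPart x := by
    rw [hz, muPart_add, muPart_lamEmbed, muPart_muEmbed, zero_add]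
  have h1s : (1 : ℝ) - s ≠ 0 := by intro h; linarith
  have hp0 : pFun κ s ≠ 0 := (pFun_pos hκ hs0).ne'
  have hsz : sOf z = s := by
    rw [sOf, hzl, norm_smul, mul_pow, norm_inv, Real.norm_of_nonneg hA0.le, hQ, inv_pow, hA2]
    field_simp
  have hmz : ‖muPart z‖ ^ 2 = u * (1 - s) := by
    rw [hzm, norm_smul, mul_pow, norm_inv, Real.norm_of_nonneg hB0.le, hP, inv_pow, hB2]
    field_simp
  have huz : uOf z = u := by
    rw [uOf, hsz, hmz]; field_simp
  refine ⟨z, hsz, hmz, ?_⟩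
  rw [modelF, hsz, huz, hzm, hzl, ← hA, ← hB, lamEmbed_smul, muEmbed_smul, smul_smul, smul_smul,
    mul_inv_cancel₀ hB0.ne', mul_inv_cancel₀ hA0.ne', one_smul, one_smul, lamEmbed_add_muEmbed]

/-- **`x ∈ 𝓕 (D⁴ ∖ S)` iff `(‖x_λ‖², ‖x_μ‖²) = (u·𝓅(s), s·q̃(s,u))` for some `0 ≤ s < 1`,
`0 ≤ u ≤ 1`.** [cite: MilnorHCobordism1965, §3] -/
theorem mem_image_modelF_iff {a κ δ : ℝ} (ha : 0 < a) (hκ : 0 < κ) (hκ2 : κ ≤ 1 / 2) (hδ : 0 < δ)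
    (hδ2 : δ ≤ 1 / 2) (x : EuclideanSpace ℝ (Fin 4)) :
    x ∈ modelF a κ δ '' {z | ‖z‖ ≤ 1 ∧ sOf z < 1} ↔
      ∃ s u : ℝ, 0 ≤ s ∧ s < 1 ∧ 0 ≤ u ∧ u ≤ 1 ∧ ‖lamPart x‖ ^ 2 = u * pFun κ s ∧
        ‖muPart x‖ ^ 2 = s * qTilde a κ δ s u := by
  constructor
  · rintro ⟨z, ⟨hz, hs⟩, rfl⟩
    exact ⟨sOf z, uOf z, sq_nonneg _, hs, uOf_nonneg hs, uOf_le_one hz hs, norm_lamPart_modelF_sq hκ hs,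
      norm_muPart_modelF_sq (qTilde_pos ha hκ hκ2 hδ hδ2 (sq_nonneg _) hs (uOf_nonneg hs) (uOf_le_one hz hs))⟩
  · rintro ⟨s, u, hs0, hs1, hu0, hu1, hP, hQ⟩
    obtain ⟨z, hsz, hmz, hzx⟩ := exists_preimage_of_param ha hκ hκ2 hδ hδ2 hs0 hs1 hu0 hu1 hP hQ
    refine ⟨z, ⟨?_, by rw [hsz]; exact hs1⟩, hzx⟩
    rw [norm_le_one_iff_parts, show ‖lamPart z‖ ^ 2 = sOf z from rfl, hsz, hmz]; nlinarith

end Param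

/-! ### §2 The image of `Λ` read in the quarter plane -/

section Plane

/-- `g a > 0` on `(0, 1)` (`0 < a`). [folklore] -/
theorem gProfile_pos {a t : ℝ} (ha : 0 < a) (ht : 0 < t) (ht1 : t < 1) : 0 < gProfile a t := by
  unfold gProfile; exact div_pos (mul_pos ha ht) (by linarith)

/-- `𝒸(P) = qHat P (P/κ²)`: the upper boundary curve of `N` is the `u = 1` value of the top-zone
profile. [folklore] -/
theorem cocoreCurve_eq_qHat (a : ℝ) {κ : ℝ} (δ P : ℝ) : cocoreCurve κ δ P = qHat a κ δ P (P / κ ^ 2) := by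
  have h0 : gProfile a (δ * (P / κ ^ 2 - P / κ ^ 2)) = 0 := by simp [gProfile]
  rw [qHat, h0, cocoreCurve]; ring

/-- **The top of the image is open**: `qHat P s < 1 + g(δ(1 - P/κ²)) - P` for `s < 1`
(`0 ≤ P ≤ κ²`, `P/κ² ≤ s`, `κ² + δ < 1`). [folklore] -/
theorem qHat_lt_top {a κ δ p s : ℝ} (ha : 0 < a) (hκ : 0 < κ) (hδ : 0 < δ) (hκδ : κ ^ 2 + δ < 1)
    (hp : 0 ≤ p) (hpκ : p ≤ κ ^ 2) (hps : p / κ ^ 2 ≤ s) (hs1 : s < 1) :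
    qHat a κ δ p s < 1 + gProfile a (δ * (1 - p / κ ^ 2)) - p := by
  unfold qHat
  have hκ2 : 0 < κ ^ 2 := by positivity
  have hp0 : 0 ≤ p / κ ^ 2 := div_nonneg hp hκ2.le
  have harg0 : 0 ≤ δ * (s - p / κ ^ 2) := mul_nonneg hδ.le (by linarith)
  have harg : δ * (s - p / κ ^ 2) < δ * (1 - p / κ ^ 2) := by nlinarith
  have harg1 : δ * (1 - p / κ ^ 2) < 1 := by nlinarith
  have hg := gProfile_lt_gProfile ha harg harg1
  have hg0 := gProfile_nonneg ha.le harg0 (harg.trans harg1)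
  have hω0 := (shellCut_mem s).1
  have hω1 := (shellCut_mem s).2
  have hδs : δ * s < 1 + gProfile a (δ * (s - p / κ ^ 2)) - p := by nlinarith
  have key : 1 + gProfile a (δ * (1 - p / κ ^ 2)) - p -
      (shellCut s * (1 + gProfile a (δ * (s - p / κ ^ 2)) - p) + (1 - shellCut s) * (δ * s)) =
      shellCut s * (gProfile a (δ * (1 - p / κ ^ 2)) - gProfile a (δ * (s - p / κ ^ 2))) +
        (1 - shellCut s) * (1 + gProfile a (δ * (1 - p / κ ^ 2)) - p - δ * s) := by ring
  have hA := sub_pos.2 hg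
  have hB : 0 < 1 + gProfile a (δ * (1 - p / κ ^ 2)) - p - δ * s := by linarith
  rcases le_or_gt (shellCut s) (1 / 2) with h | h
  · nlinarith [mul_nonneg hω0 hA.le]
  · nlinarith [mul_nonneg (sub_nonneg.2 hω1) hB.le]

/-- **`Λ([0,1) × [0,1]) ⊆ Dome ∪ N`**, read in the quarter plane. [cite: MilnorHCobordism1965, §3] -/
theorem region_of_param {a κ δ : ℝ} (ha : 0 < a) (hκ : 0 < κ) (hκ2 : κ ≤ 1 / 2) (hδ : 0 < δ)
    (hδ2 : δ ≤ 1 / 2) {s u P Q : ℝ} (hs0 : 0 ≤ s) (hs1 : s < 1) (hu0 : 0 ≤ u) (hu1 : u ≤ 1)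
    (hP : P = u * pFun κ s) (hQ : Q = s * qTilde a κ δ s u) :
    (P < κ ^ 2 ∧ 1 ≤ P + Q ∧ P + Q < 1 + gProfile a (δ * (1 - P / κ ^ 2))) ∨
      (P + Q ≤ 1 ∧ ((Q ≤ δ / 2 ∧ P ≤ pFun κ (Q / δ)) ∨
        (δ / 4 ≤ Q ∧ P ≤ 3 * κ ^ 2 / 4 ∧ cocoreCurve κ δ P ≤ Q))) := by
  have hκ2' : 0 < κ ^ 2 := by positivity
  have hκ4 : κ ^ 2 ≤ 1 / 4 := by nlinarith
  have hκδ : κ ^ 2 + δ < 1 := by linarith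
  have hp0 := pFun_pos hκ hs0
  have hP0 : 0 ≤ P := by rw [hP]; positivity
  have hPle : P ≤ pFun κ s := by rw [hP]; nlinarith
  rcases le_or_gt s (1 / 2) with h | h
  · -- the swap slab: `Q = δ s`
    rw [qTilde_of_le a κ δ h] at hQ
    have hQs : Q / δ = s := by rw [hQ]; field_simp
    refine Or.inr ⟨?_, Or.inl ⟨by rw [hQ]; nlinarith, by rw [hQs]; exact hPle⟩⟩
    have := pFun_le (κ := κ) h
    nlinarith
  · -- the top zone: `𝓅 = κ² s`, `Q = qHat P s`
    have hs14 : (1 : ℝ) / 4 ≤ s := by linarith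
    rw [pFun_of_ge κ hs14] at hP hPle
    have hPκ : P < κ ^ 2 := by nlinarith
    have hPs : P / κ ^ 2 ≤ s := by rw [div_le_iff₀ hκ2']; nlinarith
    have hQ' : Q = qHat a κ δ P s := by
      rw [hQ, sq_qTilde_eq_qHat hκ.ne' hs14, hP]; ring_nf
    have htop := qHat_lt_top ha hκ hδ hκδ hP0 hPκ.le hPs hs1
    rw [← hQ'] at htop
    by_cases h1 : 1 ≤ P + Q
    · exact Or.inl ⟨hPκ, h1, by linarith⟩
    · push Not at h1
      refine Or.inr ⟨h1.le, Or.inr ⟨?_, ?_, ?_⟩⟩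
      · -- `Q` is a convex combination of `F ≥ 1 - κ²` and `δ s > δ/2`
        rw [hQ', qHat]
        have harg0 : 0 ≤ δ * (s - P / κ ^ 2) := mul_nonneg hδ.le (by linarith)
        have harg1 : δ * (s - P / κ ^ 2) < 1 := by
          have : s - P / κ ^ 2 ≤ 1 := by linarith [div_nonneg hP0 hκ2'.le]
          nlinarith
        have hg0 := gProfile_nonneg ha.le harg0 harg1
        have hω0 := (shellCut_mem s).1
        have hω1 := (shellCut_mem s).2
        have hF : δ / 4 ≤ 1 + gProfile a (δ * (s - P / κ ^ 2)) - P := by linarith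
        have hδs : δ / 4 ≤ δ * s := by nlinarith
        nlinarith [mul_nonneg hω0 (sub_nonneg.2 hF), mul_nonneg (sub_nonneg.2 hω1) (sub_nonneg.2 hδs)]
      · by_contra hc
        push Not at hc
        have hs34 : (3 : ℝ) / 4 < s := by nlinarith
        rw [hQ', qHat, shellCut_of_ge hs34.le] at h1
        have harg0 : 0 ≤ δ * (s - P / κ ^ 2) := mul_nonneg hδ.le (by linarith)
        have harg1 : δ * (s - P / κ ^ 2) < 1 := by
          have : s - P / κ ^ 2 ≤ 1 := by linarith [div_nonneg hP0 hκ2'.le]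
          nlinarith
        have hg0 := gProfile_nonneg ha.le harg0 harg1
        linarith
      · rw [hQ', cocoreCurve_eq_qHat a δ P]
        rcases eq_or_lt_of_le hPs with he | hlt
        · rw [he]
        · exact (qHat_lt_qHat ha hκ hδ hκδ hP0 hPκ.le le_rfl hlt hs1).le

/-- The slab part of `N` is `Λ (Q/δ, P/𝓅(Q/δ))`. [folklore] -/
theorem param_of_slab {a κ δ : ℝ} (hκ : 0 < κ) (hδ : 0 < δ) {P Q : ℝ} (hP0 : 0 ≤ P) (hQ0 : 0 ≤ Q)
    (hQ : Q ≤ δ / 2) (hP : P ≤ pFun κ (Q / δ)) :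
    ∃ s u : ℝ, 0 ≤ s ∧ s < 1 ∧ 0 ≤ u ∧ u ≤ 1 ∧ P = u * pFun κ s ∧ Q = s * qTilde a κ δ s u := by
  have hs0 : 0 ≤ Q / δ := div_nonneg hQ0 hδ.le
  have hs2 : Q / δ ≤ 1 / 2 := by rw [div_le_iff₀ hδ]; linarith
  have hp := pFun_pos hκ hs0
  refine ⟨Q / δ, P / pFun κ (Q / δ), hs0, by linarith, div_nonneg hP0 hp.le, (div_le_one hp).2 hP,
    (div_mul_cancel₀ P hp.ne').symm, ?_⟩
  rw [qTilde_of_le a κ δ hs2]; field_simp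

/-- **The top zone is filled** (intermediate value theorem for the increasing continuous `qHat P`
on `[1/2 ∨ P/κ², 1]`): every `(P, Q)` with `0 ≤ P < κ²`, `δ/2 ≤ Q`, `𝒸(P) ≤ Q`,
`Q < 1 + g(δ(1 - P/κ²)) - P` is `Λ (s, P/(κ² s))` for some `s ∈ [1/2, 1)`. [folklore] -/
theorem exists_param_top (a : ℝ) {κ δ : ℝ} (hκ : 0 < κ) (hδ : 0 < δ) (hδ1 : δ < 1) {P Q : ℝ}
    (hP0 : 0 ≤ P) (hPκ : P < κ ^ 2) (hQ1 : δ / 2 ≤ Q) (hQ2 : cocoreCurve κ δ P ≤ Q)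
    (hQ3 : Q < 1 + gProfile a (δ * (1 - P / κ ^ 2)) - P) :
    ∃ s u : ℝ, 0 ≤ s ∧ s < 1 ∧ 0 ≤ u ∧ u ≤ 1 ∧ P = u * pFun κ s ∧ Q = s * qTilde a κ δ s u := by
  have hκ2 : 0 < κ ^ 2 := by positivity
  have hp0 : 0 ≤ P / κ ^ 2 := div_nonneg hP0 hκ2.le
  have hp1 : P / κ ^ 2 < 1 := by rw [div_lt_one hκ2]; exact hPκ
  set s₀ := max (1 / 2) (P / κ ^ 2) with hs₀
  have hs₀1 : s₀ < 1 := max_lt (by norm_num) hp1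
  have hs₀2 : (1 : ℝ) / 2 ≤ s₀ := le_max_left _ _
  -- continuity of `qHat P` on `[s₀, 1]`
  have hcont : ContinuousOn (qHat a κ δ P) (Icc s₀ 1) := by
    have hg : ContinuousOn (fun s : ℝ => gProfile a (δ * (s - P / κ ^ 2))) (Icc s₀ 1) := by
      refine (contDiffOn_gProfile a).continuousOn.comp
        (continuous_const.mul (continuous_id.sub continuous_const)).continuousOn fun s hs => ?_
      show δ * (s - P / κ ^ 2) < 1
      have : s - P / κ ^ 2 ≤ 1 := by linarith [hs.2]
      nlinarith
    have hω : Continuous shellCut := contDiff_cutTop.continuous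
    unfold qHat
    exact (hω.continuousOn.mul ((continuousOn_const.add hg).sub continuousOn_const)).add
      ((continuousOn_const.sub hω.continuousOn).mul (continuousOn_const.mul continuousOn_id))
  -- the end values
  have hlow : qHat a κ δ P s₀ ≤ Q := by
    rcases le_or_gt (P / κ ^ 2) (1 / 2) with h | h
    · have : s₀ = 1 / 2 := max_eq_left h
      rw [this, qHat, shellCut_of_le le_rfl]; linarith
    · have : s₀ = P / κ ^ 2 := max_eq_right h.le
      rw [this, ← cocoreCurve_eq_qHat a δ P]; exact hQ2
  have hhigh : qHat a κ δ P 1 = 1 + gProfile a (δ * (1 - P / κ ^ 2)) - P := by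
    rw [qHat, shellCut_of_ge (by norm_num)]; ring
  obtain ⟨s, hs, hsQ⟩ : Q ∈ qHat a κ δ P '' Icc s₀ 1 :=
    intermediate_value_Icc hs₀1.le hcont ⟨hlow, by rw [hhigh]; exact hQ3.le⟩
  have hs1 : s < 1 := by
    rcases eq_or_lt_of_le hs.2 with h | h
    · exfalso; rw [h, hhigh] at hsQ; linarith
    · exact h
  have hs12 : (1 : ℝ) / 2 ≤ s := hs₀2.trans hs.1
  have hs14 : (1 : ℝ) / 4 ≤ s := by linarith
  have hsP : P / κ ^ 2 ≤ s := (le_max_right _ _).trans hs.1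
  have hs0 : 0 < s := by linarith
  have hPs : P ≤ κ ^ 2 * s := by rwa [div_le_iff₀' hκ2] at hsP
  refine ⟨s, P / (κ ^ 2 * s), by linarith, hs1, by positivity, (div_le_one (by positivity)).2 hPs, ?_, ?_⟩
  · rw [pFun_of_ge κ hs14]; field_simp
  · rw [sq_qTilde_eq_qHat hκ.ne' hs14, ← hsQ]
    congr 1
    field_simp

/-- **`Dome ∪ N ⊆ Λ([0,1) × [0,1])`**, read in the quarter plane. [cite: MilnorHCobordism1965, §3] -/
theorem param_of_region {a κ δ : ℝ} (ha : 0 < a) (hκ : 0 < κ) (hκ2 : κ ≤ 1 / 2) (hδ : 0 < δ)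
    (hδ2 : δ ≤ 1 / 2) {P Q : ℝ} (hP0 : 0 ≤ P) (hQ0 : 0 ≤ Q)
    (h : (P < κ ^ 2 ∧ 1 ≤ P + Q ∧ P + Q < 1 + gProfile a (δ * (1 - P / κ ^ 2))) ∨
      (P + Q ≤ 1 ∧ ((Q ≤ δ / 2 ∧ P ≤ pFun κ (Q / δ)) ∨
        (δ / 4 ≤ Q ∧ P ≤ 3 * κ ^ 2 / 4 ∧ cocoreCurve κ δ P ≤ Q)))) :
    ∃ s u : ℝ, 0 ≤ s ∧ s < 1 ∧ 0 ≤ u ∧ u ≤ 1 ∧ P = u * pFun κ s ∧ Q = s * qTilde a κ δ s u := by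
  have hκ2' : 0 < κ ^ 2 := by positivity
  have hκ4 : κ ^ 2 ≤ 1 / 4 := by nlinarith
  have hδ1 : δ < 1 := by linarith
  rcases h with ⟨hPκ, h1, h2⟩ | ⟨hr, ⟨hQ, hP⟩ | ⟨hQ4, hP34, hc⟩⟩
  · -- the dome
    refine exists_param_top a hκ hδ hδ1 hP0 hPκ (by nlinarith) ?_ (by linarith)
    exact (cocoreCurve_le_one_sub hκ hκ2 hδ.le hδ2).trans (by linarith)
  · exact param_of_slab hκ hδ hP0 hQ0 hQ hP
  · rcases le_or_gt (δ / 2) Q with hQ2 | hQ2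
    · -- upper part of `N`: below the seam, strictly below the top of the dome
      refine exists_param_top a hκ hδ hδ1 hP0 (by nlinarith) hQ2 hc ?_
      have ht0 : 0 < δ * (1 - P / κ ^ 2) := by
        have : P / κ ^ 2 < 1 := by rw [div_lt_one hκ2']; nlinarith
        nlinarith
      have ht1 : δ * (1 - P / κ ^ 2) < 1 := by nlinarith [div_nonneg hP0 hκ2'.le]
      have := gProfile_pos ha ht0 ht1
      linarith
    · -- line part of `N`: `P ≤ κ²/2`, so `𝒸(P) = δP/κ² ≤ Q` is the slab condition
      have hP2 : P ≤ κ ^ 2 / 2 := by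
        by_contra hlt
        push Not at hlt
        have := half_lt_cocoreCurve hκ hδ hlt (by nlinarith)
        linarith
      rw [cocoreCurve_of_le hκ hP2] at hc
      refine param_of_slab hκ hδ hP0 hQ0 hQ2.le ?_
      have hs : 1 / 4 ≤ Q / δ := by rw [le_div_iff₀ hδ]; linarith
      rw [pFun_of_ge κ hs]
      rw [div_le_iff₀ hκ2'] at hc
      have : κ ^ 2 * (Q / δ) = κ ^ 2 * Q / δ := by ring
      rw [this, le_div_iff₀ hδ]; nlinarith

end Plane

/-! ### §3 The image theorem -/

section Image

/-- **THE IMAGE OF THE MODEL DUAL HANDLE MAP IS `Dome ∪ N`**: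
`modelF a κ δ '' {‖z‖ ≤ 1, ‖z_λ‖² < 1} = dualDome a κ δ ∪ cocoreNbhd κ δ`
(`0 < a`, `0 < κ ≤ 1/2`, `0 < δ ≤ 1/2`). [cite: MilnorHCobordism1965, §3] -/
theorem image_modelF_eq {a κ δ : ℝ} (ha : 0 < a) (hκ : 0 < κ) (hκ2 : κ ≤ 1 / 2) (hδ : 0 < δ)
    (hδ2 : δ ≤ 1 / 2) :
    modelF a κ δ '' {z | ‖z‖ ≤ 1 ∧ sOf z < 1} = dualDome a κ δ ∪ cocoreNbhd κ δ := by
  ext x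
  rw [mem_image_modelF_iff ha hκ hκ2 hδ hδ2]
  simp only [dualDome, cocoreNbhd, mem_union, mem_setOf_eq, norm_le_one_iff_parts,
    norm_sq_eq_lamPart_muPart x]
  constructor
  · rintro ⟨s, u, hs0, hs1, hu0, hu1, hP, hQ⟩
    exact region_of_param ha hκ hκ2 hδ hδ2 hs0 hs1 hu0 hu1 hP hQ
  · exact param_of_region ha hκ hκ2 hδ hδ2 (sq_nonneg _) (sq_nonneg _)

/-- **The dual attaching map lands in the dome**: `Π(T) ⊆ Dome`. [cite: MilnorHCobordism1965, §3] -/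
theorem dualVec_mem_dualDome {a κ δ : ℝ} (ha : 0 < a) (hκ : 0 < κ) (hκ1 : κ ≤ 1) (hδ : 0 < δ)
    (hδ2 : δ ≤ 1 / 2) (y : ↥(handleTube 3 2)) : dualVec a κ δ y ∈ dualDome a κ δ := by
  have hP : ‖lamPart (dualVec a κ δ y)‖ ^ 2 = κ ^ 2 * ‖tubeFibre y‖ ^ 2 := by
    rw [lamPart_dualVec, norm_smul, mul_pow, Real.norm_of_nonneg hκ.le]
  have hκ2 : 0 < κ ^ 2 := by positivity
  obtain ⟨ht0, ht1⟩ := mul_tubeDepth_lt_one hδ hδ2 y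
  refine ⟨?_, ?_, ?_⟩
  · rw [hP]
    have := norm_tubeFibre_lt_one y
    have h1 : ‖tubeFibre y‖ ^ 2 < 1 := by nlinarith [norm_nonneg (tubeFibre y)]
    nlinarith
  · rw [norm_dualVec_sq ha hκ hκ1 hδ hδ2]
    linarith [gProfile_nonneg ha.le ht0 ht1]
  · rw [norm_dualVec_sq ha hκ hκ1 hδ hδ2, hP, mul_div_cancel_left₀ _ hκ2.ne']
    have hlt : δ * tubeDepth y < δ * (1 - ‖tubeFibre y‖ ^ 2) := by
      have h := norm_lamPart_sq_eq y
      have h' := norm_lamPart_tubeVec_pos y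
      have : tubeDepth y < 1 - ‖tubeFibre y‖ ^ 2 := by nlinarith
      exact mul_lt_mul_of_pos_left this hδ
    have hlt1 : δ * (1 - ‖tubeFibre y‖ ^ 2) < 1 := by nlinarith [sq_nonneg ‖tubeFibre y‖]
    linarith [gProfile_lt_gProfile ha hlt hlt1]

/-- **Registered helper `helper_image_modelF` (brick (F-image) of T3b, sub-goal of NF6
`stub_steinRealisation`, wave 3, lead c5): the image of the model dual handle map on
`{‖z‖ ≤ 1, ‖z_λ‖² < 1} ⊇ D⁴ ∖ S` is `Dome ∪ N`.** [cite: MilnorHCobordism1965, §3] -/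
theorem helper_image_modelF : ∀ {a κ δ : ℝ}, 0 < a → 0 < κ → κ ≤ 1 / 2 → 0 < δ → δ ≤ 1 / 2 → Summit.SmoothPoincare4.SmoothPoincare4.Theorems.AcyclicBisectionExists.ModpBraidOrbits.modelF a κ δ '' {z : EuclideanSpace ℝ (Fin 4) | ‖z‖ ≤ 1 ∧ Summit.SmoothPoincare4.SmoothPoincare4.Theorems.AcyclicBisectionExists.ModpBraidOrbits.sOf z < 1} = Summit.SmoothPoincare4.SmoothPoincare4.Theorems.AcyclicBisectionExists.ModpBraidOrbits.dualDome a κ δ ∪ Summit.SmoothPoincare4.SmoothPoincare4.Theorems.AcyclicBisectionExists.ModpBraidOrbits.cocoreNbhd κ δ :=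
  fun ha hκ hκ2 hδ hδ2 => image_modelF_eq ha hκ hκ2 hδ hδ2

end Image

end Summit.SmoothPoincare4.SmoothPoincare4.Theorems.AcyclicBisectionExists.ModpBraidOrbits

end
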